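import Literature.AlgebraicGeometry.ComplexMultiplication.EndomorphismFieldInducedTypeHodge
import Literature.AlgebraicGeometry.Deligne1982.WeilClassesSquaresIsogenyClass
import HarnessLib

/-!
# A pair `(A, ι : F ↪ End_ℚ(A))` whose type is induced from a CM subfield `K₀` of EVEN index `[F : K₀]` is of Weil type for
# every `K = ℚ(√-D)`, with algebraic Weil classes; and `A` inherits Weil type from the CM variety of record of `(K₀; Φ₀)`

Topic `Literature/AlgebraicGeometry/ComplexMultiplication` (family `hodge`, lane `lit-hodgefound`), theorem-only sequel of
`EndomorphismFieldInducedTypeHodge` §1 (Shimura §6.2 THEOREM 3 with §6.1 COROLLARY on the algebraic carrier, intrinsic form: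
`isIsogenous_powSucc_varietyOfIdeal` — if THE type `cmTypeOfPair ι hF` of `(A, ι)` is induced from a CM type `Φ₀` of a CM
subfield `K₀ ≤ F`, then `A ∼ B^{[F:K₀]}` in both directions for the CM variety of record `B = varietyOfIdeal Φ₀ 1`,
`B^an = ℂ^{Φ₀}/D(𝔬_{K₀})`, and `dim A = [F:K₀] · dim B`), of `EndomorphismFieldInducedTypeWeilType` (the case `[K₀:ℚ] = 2`) and
of `Deligne1982/WeilClassesSquaresIsogenyClass` (everything isogenous to an even power `X^{2k}` carries, for every `D ≥ 1`, a
Weil-type structure of type `(k·dim X, N²D)` all of whose Weil classes are algebraic; `HodgeTheory.WeilType` passes along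
isogenies and to powers). No definition, no named fact, sorry-free.

## The printed statements

* G. Shimura, *Abelian Varieties with Complex Multiplication and Modular Functions* (1998) [Shimura1998], §6.2 Thm. 3 and its
  proof (pp. 42–44): for `(F; {φᵢ})` induced from `(K; {ψⱼ})`, «`ℂⁿ/D(𝔪)` is complex analytically isomorphic to the direct
  product of `h` copies of `ℂ^m/Δ`», `h = [F : K]`; §6.1 Cor. of Thm. 2 (p. 41): «any two abelian varieties of the same
  CM-type are isogenous».
* P. Deligne (notes by J. Milne), LNM 900 (1982) [Deligne1982HodgeCycles], §4 Lemma 4.5 and proof of Thm. 4.8 (a)–(b): the point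
  `A₀ ⊗_ℚ E` of the Weil-type family (here `A₀ = B^{h/2}`, `E = ℚ(√-D)`) satisfies (4.4) and its Weil classes come from
  `H^d_B(A₀)(d/2)`.
* B. van Geemen, LNM 1594 (1994) [vanGeemen1994HodgeAV], 3.6–3.7 (isogenies) and 4.9 (the definition).
* B. Moonen, Yu. Zarhin, Math. Ann. 315 (1999) [MoonenZarhin1999LowDim], (1.9), and Introduction case (e) («`X` is isogenous to
  `X₁² × X₂`»).

## What is proved (hypotheses: Shimura's pair `(A, ι)`, `[F:ℚ] = 2 dim A`, `IsCMField K₀`, `inducedCMType (algebraMap K₀ F) Φ₀ =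
cmTypeOfPair ιF hF`)

* **`exists_isWeilType_algebraic_of_inducedCMType_of_even_finrank`** — if `[F : K₀] = 2(a+1)` is EVEN then for every `D ≥ 1`
  there are `ψ ∈ End(A)`, `N ≥ 1` with `(A, ψ)` of Weil type `((a+1)·dim B, N²D)` (`B = varietyOfIdeal Φ₀ 1`) ALL OF WHOSE WEIL
  CLASSES ARE ALGEBRAIC; **`weilType_of_inducedCMType_of_even_finrank`** — such an `A` is of Weil type.
* **`weilType_of_inducedCMType_of_weilType_varietyOfIdeal`** — for ANY index: if the CM variety of record `B` is of Weil type,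
  so is `A` (`A ∼ B^{[F:K₀]}`, `WeilType.powSucc`, isogeny invariance).
* `weilType_of_inducedCMType_iff_of_odd_dim_varietyOfIdeal` — if `dim B` is odd: `WeilType A ↔ Even [F : K₀]`
  (generalising `EndomorphismFieldInducedTypeWeilType`: `[K₀ : ℚ] = 2`, `dim B = 1`).
-/

noncomputable section

namespace Literature.AlgebraicGeometry.ComplexMultiplication

open CategoryTheory NumberField Module
open scoped nonZeroDivisors
open Literature.AlgebraicGeometry.Motives Literature.AlgebraicGeometry.HodgeTheory
open Literature.NumberTheory.ComplexMultiplication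

namespace EndFieldFullDegree

variable {F : Type} [Field F] [NumberField F] {A : AbelianVariety ℂ}
  (ιF : F →+* A.endAlgebra) (hF : finrank ℚ F = 2 * A.dim)
  {K₀ : IntermediateField ℚ F} {Φ₀ : CMType K₀} [IsCMField K₀]
  (hΦ : inducedCMType (algebraMap K₀ F) Φ₀ = cmTypeOfPair ιF hF)

/-- `dim B ≥ 1` for the CM variety of record (`2 dim B = [K₀ : ℚ] ≥ 1`). [folklore] -/
private theorem dim_varietyOfIdeal_pos : 0 < (CMTorusRealisation.varietyOfIdeal Φ₀ (1 : (FractionalIdeal (𝓞 K₀)⁰ K₀)ˣ)).dim := by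
  have h := CMTorusRealisation.two_mul_dim_varietyOfIdeal Φ₀ (1 : (FractionalIdeal (𝓞 K₀)⁰ K₀)ˣ)
  have hK : 0 < finrank ℚ K₀ := finrank_pos
  omega

include hΦ in
/-- **EVEN INDEX `[F : K₀]` ⟹ WEIL TYPE FOR EVERY `K`, WITH ALGEBRAIC WEIL CLASSES.**  If THE type of `(A, ι)` is induced from a CM
type `Φ₀` of a CM subfield `K₀ ≤ F` with `[F : K₀] = 2(a+1)` even, then for every `D ≥ 1` there are `ψ ∈ End(A)` and `N ≥ 1` with
`(A, ψ)` of Weil type `((a+1)·dim B, N²D)` — `ℚ(ψ) ≅ ℚ(√-D)` — all of whose Weil classes are algebraic: `A ∼ B^{2a+2}` (Shimura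
§6.2 Thm. 3), and everything isogenous to an even power carries such a structure (Deligne's `B^{a+1} ⊗_ℚ ℚ(√-D)`, Lemma 4.5,
transported; `Deligne1982.exists_isWeilType_algebraic_of_isIsogenous_powSucc_two_mul_add_one`).
[cite: Shimura1998, §6.2 Thm. 3 (proof), pp. 42–44; §6.1 Cor. of Thm. 2, p. 41] [cite: Deligne1982HodgeCycles, §4 Lemma 4.5 and proof of Thm. 4.8 (a)–(b)]
[cite: vanGeemen1994HodgeAV, 3.6–3.7 and 4.9] -/
theorem exists_isWeilType_algebraic_of_inducedCMType_of_even_finrank {a : ℕ} (ha : finrank K₀ F = 2 * a + 2) {D : ℕ}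
    (hD : 0 < D) :
    ∃ (ψ : A ⟶ A) (N : ℕ), 0 < N ∧
      IsWeilType A ψ ((a + 1) * (CMTorusRealisation.varietyOfIdeal Φ₀ (1 : (FractionalIdeal (𝓞 K₀)⁰ K₀)ˣ)).dim) (N ^ 2 * D) ∧
      weilClassesOf A ψ ((a + 1) * (CMTorusRealisation.varietyOfIdeal Φ₀ (1 : (FractionalIdeal (𝓞 K₀)⁰ K₀)ˣ)).dim) (N ^ 2 * D) ≤
        algebraicClasses A.X ((a + 1) * (CMTorusRealisation.varietyOfIdeal Φ₀ (1 : (FractionalIdeal (𝓞 K₀)⁰ K₀)ˣ)).dim) := by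
  obtain ⟨-, hBA, -⟩ := isIsogenous_powSucc_varietyOfIdeal ιF hF hΦ
  rw [ha, show 2 * a + 2 - 1 = 2 * a + 1 by omega] at hBA
  exact Deligne1982.exists_isWeilType_algebraic_of_isIsogenous_powSucc_two_mul_add_one dim_varietyOfIdeal_pos hD a hBA

include hΦ in
/-- **… in particular such an `A` is of Weil type** (`[F : K₀]` even). [cite: Shimura1998, §6.2 Thm. 3 (proof), pp. 42–44]
[cite: Deligne1982HodgeCycles, §4, proof of Thm. 4.8 (a)–(b)] [cite: vanGeemen1994HodgeAV, 4.9] -/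
theorem weilType_of_inducedCMType_of_even_finrank (hev : Even (finrank K₀ F)) : WeilType A := by
  obtain ⟨k, hk⟩ := hev
  have hpos : 0 < finrank K₀ F := finrank_pos
  obtain ⟨a, ha⟩ : ∃ a, finrank K₀ F = 2 * a + 2 := ⟨k - 1, by omega⟩
  obtain ⟨ψ, N, -, hψ, -⟩ := exists_isWeilType_algebraic_of_inducedCMType_of_even_finrank ιF hF hΦ ha one_pos
  exact ⟨_, _, ψ, hψ⟩

include hΦ in
/-- **`A` inherits Weil type from the CM variety of record `B = varietyOfIdeal Φ₀ 1`, for ANY index**: `A ∼ B^{[F:K₀]}`, powers of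
a Weil-type variety are of Weil type (`WeilType.powSucc`) and Weil type passes along isogenies.
[cite: Shimura1998, §6.2 Thm. 3 (proof), pp. 42–44] [cite: vanGeemen1994HodgeAV, 4.9 and proof of Lemma 5.2 (3)] [cite: MoonenZarhin1999LowDim, (1.9)] -/
theorem weilType_of_inducedCMType_of_weilType_varietyOfIdeal
    (hB : WeilType (CMTorusRealisation.varietyOfIdeal Φ₀ (1 : (FractionalIdeal (𝓞 K₀)⁰ K₀)ˣ))) : WeilType A := by
  obtain ⟨-, hBA, -⟩ := isIsogenous_powSucc_varietyOfIdeal ιF hF hΦ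
  exact (hB.powSucc _).of_isIsogenous hBA

include hΦ in
/-- **If `dim B` is odd, `WeilType A ↔ [F : K₀]` even** (`dim A = [F:K₀] · dim B` must be even for Weil type; conversely the
even-index theorem) — the case `[K₀ : ℚ] = 2`, `dim B = 1` is `EndomorphismFieldInducedTypeWeilType`.
[cite: Shimura1998, §6.2 Thm. 3 (proof), pp. 42–44] [cite: vanGeemen1994HodgeAV, 4.9] -/
theorem weilType_of_inducedCMType_iff_of_odd_dim_varietyOfIdeal
    (hodd : Odd (CMTorusRealisation.varietyOfIdeal Φ₀ (1 : (FractionalIdeal (𝓞 K₀)⁰ K₀)ˣ)).dim) :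
    WeilType A ↔ Even (finrank K₀ F) := by
  refine ⟨fun h => ?_, weilType_of_inducedCMType_of_even_finrank ιF hF hΦ⟩
  obtain ⟨-, -, hdim⟩ := isIsogenous_powSucc_varietyOfIdeal ιF hF hΦ
  have he := h.even_dim
  rw [hdim, Nat.even_mul] at he
  exact he.resolve_right (Nat.not_even_iff_odd.2 hodd)

end EndFieldFullDegree

end Literature.AlgebraicGeometry.ComplexMultiplication

end
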